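import Summits.QuantumFields.BalabanUV.T4Continuum.Spine.NE1p.DressedSmallFieldOuterCount
import Summits.QuantumFields.BalabanUV.T4Continuum.Spine.NE1p.DressedSmallFieldInnerLink

/-!
# T⁴ programme, spine estimate NE1′ (node O3b/H2) — THE (2.27)∘(2.37) LINK OF THE THIRD∕FOURTH RESUMMATION STEPS IS (2.27) ON THE
# AUGMENTED FAMILY TOO: N0v's displayed `hlink` (`d(Z) − c'·#W′ + 5 ≤ Σ_{Z′∈F}(d Z′ + 5)`) DISCHARGED at `c' = 5 + u₀` by crew row
# `DressedSmallFieldInnerLink.link_of_ineq227'` (unit domains on the STEP geometry itself), `c' = 5` on pv22's torus; N0v's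
# outer-label END re-fired ONCE WITHOUT the link binder, abstract and on the torus

Cell `pub-balaban`, sub-cell `t4`, BINDER-OWNERS row NE1′; crew `b2b-balaban-t4-ne1p-formalise-*`, seat `…-leaf-07` (gen 16); crew row
**S40 PART 2** ∕ DAG N29zzl (ADDENDUM `HOME/CLAIMS.log` l.19407; BOOKED typer gen 6 R-T125 (iii) l.19575; cap 300; imports the owner's N0v
`Spine/NE1p/DressedSmallFieldOuterCount` + PART 1 `Spine/NE1p/DressedSmallFieldInnerLink` ONLY; preconditions N0v LANDED ∧ PART 1 LANDED;
cross-read X157).  THEOREMS ONLY (0 def, 0 `def … : Prop`, 0 cite); nothing of N0v ∕ PART 1 restated — used BY NAME.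

WORDING OF RECORD (crew row S40 = DAG N29zzl, typer gen 6 R-T125 (iii), (D1) two parts; cross-read X157; the typer's rider, ADOPTED
VERBATIM): «(2.27) is the Geometry FIELD `ineq227` used BY NAME; `c₃₂ = 5` (and the `+u₀` relative form) is the typed constant of OUR
link SHAPE on geometries whose cubes are unit domains; print's 4∕5∕17∕«½M⁻⁴» are TYPE∕CONTEXT only; (2.32)∕(2.36)–(2.37)∕(1.28) stay
DISPLAYED».

WHAT.  §1 `attachedPart_locE_le_of_coresAt_pencil_outerLabels_of_units` — the owner's N0v END `attachedPart_locE_le_of_coresAt_pencil_outerLabels`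
ONCE BY NAME, every binder VERBATIM except `hlink ↦ (unit, hcubes, hu₀)` (the step geometry's cubes are footprints of unit domains of size
`≤ u₀`) supplied by PART 1's `link_of_ineq227'`, and `c' ↦ 5 + u₀` inside `hRR` (`u := v·e^{R(5+u₀)}`).  §2 `…_outerLabels_torus` — §1 at
`D := tsys 4 N`, `G := tgeometry 4 N`, unit domains the single cubes (`u₀ = 0`, `c' = 5`): NO link binder, NO geometry hypothesis; pv22's
located letters by `torus_consts` ∕ `K₀_four`; conclusion in the crew's torus currency (S34∕S39∕S40.1 §4).

HONEST FRAMING (c3∕c4∕c6∕k1–k3).  A by-name composition over hypothesis SHAPES: N0v's END + PART 1's link; (2.27) is the `Geometry` FIELD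
used BY NAME (pv22's theorem on the torus); print's `4`∕`5`∕`17`∕«½M⁻⁴» are TYPE∕CONTEXT words; `hadm` ∕ `hAmp` ∕ `hmember` ∕ the clauses
stay DISPLAYED exactly as N0v displays them ((B1b)-READING identifications, the (2.36)∕(1.28)-KIND member bound); (2.32) proper, (2.36)–(2.37)
and (1.28) stay DISPLAYED; (B1)∕(B3)∕(B5) for Bałaban's (2.14) objects NOT discharged; 0 binders instantiated on Bałaban's densities; no wall
item; wall v1.7 (T4-DAG v46) does NOT move; R-t4r2-Q2 NOT met thereby; NE1′ ⇐ the named binders — NOT proved, NOT printed; spine PROVED 0∕9;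
count 9 unchanged.  [folklore] tags on kernel lemmas only; no placeholders; no citations; no internally-minted statement becomes a cited fact
(ABSOLUTE RULE).  Rung (B)+1 on ONE finite four-torus — NOT infinite volume, NOT a mass gap, NOT OS on ℝ⁴, NOT Clay.  HONEST DEPENDENCY:
continuum YM on T⁴ ⇐ BetaPertH ∧ nine spine estimates (0/9 proved); BetaPertH ⇐ (D1) ∧ (D4) ∧ CAP+tail; G-an2-4 gates asym, D1 and
NE2/3/4. -/
noncomputable section

namespace Summit.QuantumFields.BalabanUV.T4Continuum.NE1p.DressedSmallFieldOuterLink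

open Metric Set Complex MeasureTheory
open scoped BigOperators
open Literature.MathematicalPhysics.QuantumFieldTheory.Balaban1983to89 (LocDomainSys)
open Literature.MathematicalPhysics.QuantumFieldTheory.Balaban1983to89.B13FamilySum (coveringFamilies mem_coveringFamilies)
open Literature.MathematicalPhysics.QuantumFieldTheory.Balaban1983to89.T4OutputRate (Carriers)
open Literature.MathematicalPhysics.QuantumFieldTheory.Balaban1983to89.B13Resummation (locE Geometry)
open Literature.MathematicalPhysics.QuantumFieldTheory.Balaban1983to89.B12TreeDecay (K₀)
open Literature.MathematicalPhysics.QuantumFieldTheory.Balaban1983to89.TreeLengthTorus (TPt TDom IsTDom tsys torusTreeLen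
  torusTreeLen_singleton)
open Literature.MathematicalPhysics.QuantumFieldTheory.Balaban1983to89.TreeLengthTorusGeometry (TTouch tgeometry)
open Summit.QuantumFields.BalabanUV.T4Continuum.B13HistMeasurable (MeasPotFrame B13HistM)
open Summit.QuantumFields.BalabanUV.T4Continuum.B13TermParamGaussianBi (BiCore)
open Summit.QuantumFields.BalabanUV.T4Continuum.NE1p.DressedSmallFieldGeometry (torus_consts)
open Summit.QuantumFields.BalabanUV.T4Continuum.NE1p.DressedSmallFieldGeometryFaces (K₀_four)
open Summit.QuantumFields.BalabanUV.T4Continuum.NE1p.DressedSmallFieldInnerLink (link_of_ineq227')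
open Summit.QuantumFields.BalabanUV.T4Continuum.NE1p.DressedSmallFieldOuterCount (attachedPart_locE_le_of_coresAt_pencil_outerLabels)

/-! ## §1 N0v's OUTER-LABEL END WITH THE LINK BINDER DISCHARGED (abstract step geometry with unit domains) -/

section End

variable {C : Carriers} {P : MeasPotFrame C} {Op : Type*} [NormedAddCommGroup Op] [NormedSpace ℂ Op]
variable (D : LocDomainSys) {Cube : Type} [DecidableEq Cube] (G : Geometry D Cube) {κ : D.Dom → Type}
  {𝒴 : ℕ → (Σ _ : Finset Cube, Σ F : Finset D.Dom, ∀ Z ∈ F, κ Z) → Type*} {dom : ∀ k i, 𝒴 k i → C.Dom}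
  {β : ℕ → (Σ _ : Finset Cube, Σ F : Finset D.Dom, ∀ Z ∈ F, κ Z) → Type*} [∀ k i, MeasurableSpace (β k i)]
  {α : ℕ → (Σ _ : Finset Cube, Σ F : Finset D.Dom, ∀ Z ∈ F, κ Z) → Type*} [∀ k i, NormedAddCommGroup (α k i)]
  [∀ k i, InnerProductSpace ℝ (α k i)] [∀ k i, FiniteDimensional ℝ (α k i)] [∀ k i, MeasurableSpace (α k i)]
  [∀ k i, BorelSpace (α k i)]

open Classical in
/-- **N0v's OUTER-LABEL END WITHOUT THE LINK BINDER** (kernel; the owner's `attachedPart_locE_le_of_coresAt_pencil_outerLabels` ONCE BY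
NAME, every binder VERBATIM except `hlink ↦ (unit, hcubes, hu₀)` — the step geometry's cubes are footprints of unit domains of size
`≤ u₀` — supplied by `DressedSmallFieldInnerLink.link_of_ineq227'`, and `c' ↦ 5 + u₀` inside `hRR` (`u := v·e^{R(5+u₀)}`).
Conclusion LITERALLY N0v's. [folklore] -/
theorem attachedPart_locE_le_of_coresAt_pencil_outerLabels_of_units {Win : Set (ℕ → ℝ)}
    {ctr : ℕ → (ℕ → ℝ) → C.BgB → Op × B13HistM P} {ROp RHist R' : ℕ → ℝ}
    (𝔊 : ∀ k i, C.Dom → BiCore P (dom k i) Op (β k i) (α k i))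
    {mq bq N₀ : ℕ → (Σ _ : Finset Cube, Σ F : Finset D.Dom, ∀ Z ∈ F, κ Z) → C.Dom → ℝ}
    (hroom : ∀ k, ROp k < R' k)
    (hm : ∀ k, ∀ g ∈ Win, ∀ (U : C.BgB) (X : C.Dom), C.scale X = k → ∀ i, 0 < mq k i X)
    (hN : ∀ k, ∀ g ∈ Win, ∀ (U : C.BgB) (X : C.Dom), C.scale X = k → ∀ i,
      (∀ o ∈ ball (ctr k g U).1 (R' k), AEStronglyMeasurable ((𝔊 k i X).N o) (𝔊 k i X).lam) ∧
      (∀ p, DifferentiableOn ℂ (fun o => (𝔊 k i X).N o p) (ball (ctr k g U).1 (R' k))) ∧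
      (∀ o ∈ ball (ctr k g U).1 (R' k), ∀ p, ‖(𝔊 k i X).N o p‖ ≤ N₀ k i X))
    (hq : ∀ k, ∀ g ∈ Win, ∀ (U : C.BgB) (X : C.Dom), C.scale X = k → ∀ i,
      (∀ o ∈ ball (ctr k g U).1 (R' k),
        AEStronglyMeasurable (Function.uncurry ((𝔊 k i X).q o)) ((𝔊 k i X).lam.prod volume)) ∧
      (∀ p v, DifferentiableOn ℂ (fun o => (𝔊 k i X).q o p v) (ball (ctr k g U).1 (R' k))) ∧
      (∀ o ∈ ball (ctr k g U).1 (R' k), ∀ p v, mq k i X * ‖v‖ ^ 2 - bq k i X ≤ ((𝔊 k i X).q o p v).re))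
    {k : ℕ} {g : ℕ → ℝ} (hg : g ∈ Win) {U : C.BgB} {o : Op} {h₀ w : B13HistM P} {ϱ : ℝ}
    (hO : ‖o - (ctr k g U).1‖ ≤ ROp k) (hH : ‖h₀ - (ctr k g U).2‖ + ϱ * ‖w‖ ≤ RHist k)
    {emb : D.Dom → C.Dom} (hscale : ∀ Z, C.scale (emb Z) = k)
    {terms : D.Dom → Finset (Σ _ : Finset Cube, Σ F : Finset D.Dom, ∀ Z ∈ F, κ Z)} {act : ℂ → D.Dom → ℂ}
    (hact : ∀ σ ∈ ball (0 : ℂ) ϱ, ∀ Z, act σ Z = ∑ i ∈ terms Z, (𝔊 k i (emb Z)).termAt o (h₀ + σ • w))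
    {A₀ A₁ Rkp r₁ b₅ : ℝ} {X₀ : D.Dom} (hA₀ : 0 ≤ A₀) (hA₁ : 0 ≤ A₁) (hr₁ : 0 ≤ r₁) (hb : r₁ * 5 ≤ b₅)
    (hrate : r₁ + 2 * G.κ₀ + 2 ≤ Rkp) (hsmall : (A₀ + ϱ * A₁) * Real.exp (b₅ + 1) * G.K₀ * G.ν * G.c₁ ≤ 1)
    (J : ∀ Z : D.Dom, Finset (κ Z)) (n : ∀ Z : D.Dom, κ Z → ℝ) (hn : ∀ Z j, 0 ≤ n Z j)
    {a r R v : ℝ} (ha : 0 ≤ a) (hv : 0 ≤ v)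
    (hκ : G.κ₀ + 1 ≤ r) (h229 : Real.exp 1 * G.K₀ * G.c₁ * a ≤ 1)
    (hmember : ∀ Z', ∑ j ∈ J Z', n Z' j ≤ a * Real.exp (-(r * D.dj Z')) * Real.exp (-(R * (D.dj Z' + 5))))
    (unit : Cube → D.Dom) (hcubes : ∀ c, G.cubes (unit c) = {c}) {u₀ : ℝ} (hu₀ : ∀ c, D.dj (unit c) ≤ u₀)
    (hRR : Rkp ≤ R - G.c₁ * (v * Real.exp (R * (5 + u₀))))
    (hadm : ∀ Z, ∀ l ∈ terms Z, l.1 ⊆ G.cubes Z ∧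
      l.2.1 ∈ coveringFamilies Finset.univ G.cubes (G.cubes Z \ l.1) ∧ ∀ Z' (h : Z' ∈ l.2.1), l.2.2 Z' h ∈ J Z')
    (hAmp : ∀ Z, G.cubes Z ⊆ G.cubes X₀ → ∀ l ∈ terms Z,
      (𝔊 k l (emb Z)).lam.real univ * ((𝔊 k l (emb Z)).wB * N₀ k l (emb Z) * Real.exp (bq k l (emb Z))) *
          (Real.pi / (mq k l (emb Z) / 2)) ^ (Module.finrank ℝ (α k l) / 2 : ℝ) *
        Real.exp ((𝔊 k l (emb Z)).N₁ * (‖h₀‖ + ϱ * ‖w‖)) ≤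
      (A₀ + ϱ * A₁) * (v ^ l.1.card * ∏ x ∈ l.2.1.attach, n x.1 (l.2.2 x.1 x.2)))
    (hϱ : 2 ≤ ϱ) (hϱA : A₀ ≤ ϱ * A₁) :
    ‖locE G.ι G.cubes (act 1) (G.cubes X₀) - locE G.ι G.cubes (act 0) (G.cubes X₀)‖ ≤
      4 * (Real.exp 1 * G.ν * G.c₁ * G.K₀ ^ 2) * A₁ * Real.exp (-(r₁ * D.dj X₀)) :=
  attachedPart_locE_le_of_coresAt_pencil_outerLabels D G 𝔊 hroom hm hN hq hg hO hH hscale hact hA₀ hA₁ hr₁ hb hrate hsmall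
    J n hn ha hv hκ h229 hmember (fun Z W hW F hF => link_of_ineq227' G unit hcubes hu₀ Z W hW F hF) hRR hadm hAmp hϱ hϱA

end End

/-! ## §2 ON THE TORUS OF THE PAPERS: NO link binder, NO geometry hypothesis; located numerals -/

section TorusEnd

variable {N : ℕ} [NeZero N]
variable {C : Carriers} {P : MeasPotFrame C} {Op : Type*} [NormedAddCommGroup Op] [NormedSpace ℂ Op] {κ : TDom 4 N → Type}
  {𝒴 : ℕ → (Σ _ : Finset (TPt 4 N), Σ F : Finset (TDom 4 N), ∀ Z ∈ F, κ Z) → Type*} {dom : ∀ k i, 𝒴 k i → C.Dom}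
  {β : ℕ → (Σ _ : Finset (TPt 4 N), Σ F : Finset (TDom 4 N), ∀ Z ∈ F, κ Z) → Type*} [∀ k i, MeasurableSpace (β k i)]
  {α : ℕ → (Σ _ : Finset (TPt 4 N), Σ F : Finset (TDom 4 N), ∀ Z ∈ F, κ Z) → Type*} [∀ k i, NormedAddCommGroup (α k i)]
  [∀ k i, InnerProductSpace ℝ (α k i)] [∀ k i, FiniteDimensional ℝ (α k i)] [∀ k i, MeasurableSpace (α k i)]
  [∀ k i, BorelSpace (α k i)]

open Classical in
/-- **N0v's OUTER-LABEL END ON THE TORUS OF THE PAPERS — NO LINK BINDER, NO GEOMETRY HYPOTHESIS** (kernel; §1 at `D := tsys 4 N`,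
`G := tgeometry 4 N`, unit domains the single cubes (`u₀ = 0`, so `c' = 5`), pv22's located letters by `torus_consts` ∕ `K₀_four`):
the displayed clauses read `64·log 162 + 1 ≤ r`, `e·K₀(64,8)·64·a ≤ 1`, `r₁ + 2·(64 log 162) + 2 ≤ Rkp ≤ R − 64·(v·e^{5R})`,
`(A₀ + ϱA₁)·e^{5r₁+1}·K₀(64,8)·9·64 ≤ 1`; conclusion in the crew's torus currency. [folklore] -/
theorem attachedPart_locE_le_of_coresAt_pencil_outerLabels_torus {Win : Set (ℕ → ℝ)}
    {ctr : ℕ → (ℕ → ℝ) → C.BgB → Op × B13HistM P} {ROp RHist R' : ℕ → ℝ}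
    (𝔊 : ∀ k i, C.Dom → BiCore P (dom k i) Op (β k i) (α k i))
    {mq bq N₀ : ℕ → (Σ _ : Finset (TPt 4 N), Σ F : Finset (TDom 4 N), ∀ Z ∈ F, κ Z) → C.Dom → ℝ}
    (hroom : ∀ k, ROp k < R' k)
    (hm : ∀ k, ∀ g ∈ Win, ∀ (U : C.BgB) (X : C.Dom), C.scale X = k → ∀ i, 0 < mq k i X)
    (hN : ∀ k, ∀ g ∈ Win, ∀ (U : C.BgB) (X : C.Dom), C.scale X = k → ∀ i,
      (∀ o ∈ ball (ctr k g U).1 (R' k), AEStronglyMeasurable ((𝔊 k i X).N o) (𝔊 k i X).lam) ∧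
      (∀ p, DifferentiableOn ℂ (fun o => (𝔊 k i X).N o p) (ball (ctr k g U).1 (R' k))) ∧
      (∀ o ∈ ball (ctr k g U).1 (R' k), ∀ p, ‖(𝔊 k i X).N o p‖ ≤ N₀ k i X))
    (hq : ∀ k, ∀ g ∈ Win, ∀ (U : C.BgB) (X : C.Dom), C.scale X = k → ∀ i,
      (∀ o ∈ ball (ctr k g U).1 (R' k),
        AEStronglyMeasurable (Function.uncurry ((𝔊 k i X).q o)) ((𝔊 k i X).lam.prod volume)) ∧
      (∀ p v, DifferentiableOn ℂ (fun o => (𝔊 k i X).q o p v) (ball (ctr k g U).1 (R' k))) ∧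
      (∀ o ∈ ball (ctr k g U).1 (R' k), ∀ p v, mq k i X * ‖v‖ ^ 2 - bq k i X ≤ ((𝔊 k i X).q o p v).re))
    {k : ℕ} {g : ℕ → ℝ} (hg : g ∈ Win) {U : C.BgB} {o : Op} {h₀ w : B13HistM P} {ϱ : ℝ}
    (hO : ‖o - (ctr k g U).1‖ ≤ ROp k) (hH : ‖h₀ - (ctr k g U).2‖ + ϱ * ‖w‖ ≤ RHist k)
    {emb : (tsys 4 N).Dom → C.Dom} (hscale : ∀ Z, C.scale (emb Z) = k)
    {terms : (tsys 4 N).Dom → Finset (Σ _ : Finset (TPt 4 N), Σ F : Finset (TDom 4 N), ∀ Z ∈ F, κ Z)}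
    {act : ℂ → (tsys 4 N).Dom → ℂ}
    (hact : ∀ σ ∈ ball (0 : ℂ) ϱ, ∀ Z, act σ Z = ∑ i ∈ terms Z, (𝔊 k i (emb Z)).termAt o (h₀ + σ • w))
    {A₀ A₁ Rkp r₁ : ℝ} (X₀ : (tsys 4 N).Dom) (hA₀ : 0 ≤ A₀) (hA₁ : 0 ≤ A₁) (hr₁ : 0 ≤ r₁)
    (hrate : r₁ + 2 * (64 * Real.log 162) + 2 ≤ Rkp)
    (hsmall : (A₀ + ϱ * A₁) * Real.exp (5 * r₁ + 1) * K₀ 64 8 * 9 * 64 ≤ 1)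
    (J : ∀ Z : TDom 4 N, Finset (κ Z)) (n : ∀ Z : TDom 4 N, κ Z → ℝ) (hn : ∀ Z j, 0 ≤ n Z j)
    {a r R v : ℝ} (ha : 0 ≤ a) (hv : 0 ≤ v)
    (hκ : 64 * Real.log 162 + 1 ≤ r) (h229 : Real.exp 1 * K₀ 64 8 * 64 * a ≤ 1)
    (hmember : ∀ Z' : (tsys 4 N).Dom, ∑ j ∈ J Z', n Z' j ≤
      a * Real.exp (-(r * torusTreeLen Z'.1)) * Real.exp (-(R * (torusTreeLen Z'.1 + 5))))
    (hRR : Rkp ≤ R - 64 * (v * Real.exp (R * 5)))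
    (hadm : ∀ Z : (tsys 4 N).Dom, ∀ l ∈ terms Z, l.1 ⊆ Z.1 ∧
      l.2.1 ∈ coveringFamilies Finset.univ (fun Y : (tsys 4 N).Dom => Y.1) (Z.1 \ l.1) ∧
        ∀ Z' (h : Z' ∈ l.2.1), l.2.2 Z' h ∈ J Z')
    (hAmp : ∀ Z : (tsys 4 N).Dom, Z.1 ⊆ X₀.1 → ∀ l ∈ terms Z,
      (𝔊 k l (emb Z)).lam.real univ * ((𝔊 k l (emb Z)).wB * N₀ k l (emb Z) * Real.exp (bq k l (emb Z))) *
          (Real.pi / (mq k l (emb Z) / 2)) ^ (Module.finrank ℝ (α k l) / 2 : ℝ) *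
        Real.exp ((𝔊 k l (emb Z)).N₁ * (‖h₀‖ + ϱ * ‖w‖)) ≤
      (A₀ + ϱ * A₁) * (v ^ l.1.card * ∏ x ∈ l.2.1.attach, n x.1 (l.2.2 x.1 x.2)))
    (hϱ : 2 ≤ ϱ) (hϱA : A₀ ≤ ϱ * A₁) :
    ‖locE (TTouch (d := 4) (N := N)) (fun Z : (tsys 4 N).Dom => Z.1) (act 1) X₀.1 -
        locE (TTouch (d := 4) (N := N)) (fun Z : (tsys 4 N).Dom => Z.1) (act 0) X₀.1‖ ≤
      4 * (Real.exp 1 * 9 * 64 * K₀ 64 8 ^ 2) * A₁ * Real.exp (-(r₁ * torusTreeLen X₀.1)) := by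
  obtain ⟨hν, hκ₀, hc⟩ := torus_consts N
  have hK₀ := K₀_four (N := N)
  have hdom : ∀ p : TPt 4 N, IsTDom ({p} : Finset (TPt 4 N)) := fun p =>
    ⟨Finset.singleton_nonempty p, fun x hx y hy => by
      rw [Finset.mem_singleton] at hx hy; subst hx; subst hy; exact Relation.ReflTransGen.refl⟩
  have h := attachedPart_locE_le_of_coresAt_pencil_outerLabels_of_units (tsys 4 N) (tgeometry 4 N) 𝔊 hroom hm hN hq hg hO hH
    hscale hact (Rkp := Rkp) (b₅ := 5 * r₁) (X₀ := X₀) hA₀ hA₁ hr₁ (le_of_eq (by ring)) (by rw [hκ₀]; exact hrate)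
    (by rw [hK₀, hν, hc]; exact hsmall) J n hn ha hv (by rw [hκ₀]; exact hκ) (by rw [hK₀, hc]; exact h229) hmember
    (fun p => (⟨{p}, hdom p⟩ : TDom 4 N)) (fun _ => rfl) (u₀ := 0) (fun p => le_of_eq (torusTreeLen_singleton p))
    (by rw [hc, show (5 : ℝ) + 0 = 5 by norm_num]; exact hRR) hadm hAmp hϱ hϱA
  rw [hν, hc, hK₀] at h
  exact h

end TorusEnd

end Summit.QuantumFields.BalabanUV.T4Continuum.NE1p.DressedSmallFieldOuterLink

end
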